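import Mathlib
import HarnessLib

/-!
# Stub `stub_inertFrobeniusTransport`, algebraic lemmas (line `inert-fl-transfer`, crux
`ResidueParallel`, stmt-Langlands-17003)

General algebra behind the Frobenius power law `ψ_m(σ') = ψ_m(σ)^{p^j}` for the fundamental
characters under base change at an inert prime (file
`NonParallelVoidResidueParallelStubInertFrobeniusTransport.lean`):

* `inertFrob_exists_frobPow_of_ringHom` — **an endomorphism of a field of characteristic `p` acts on
  the solutions of `x ^ (p ^ r) = x` as a power of Frobenius**: these solutions form a finite subfield
  `k`, every ring endomorphism of `k` is a power of the absolute Frobenius (Galois theory of finite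
  fields, Mathlib `FiniteField.bijective_frobeniusAlgHom_pow`);
* `inertFrob_odd_of_frobPow` — if moreover the endomorphism moves some `y` with `y ^ (p ^ 2) = y`,
  the exponent (taken on `x ^ (p ^ 4) = x`) is odd;
* `inertFrob_exists_odd_exponent` — the same two facts read modulo a maximal ideal `𝔓 ∋ p` stable
  under an automorphism `h` of a commutative ring `B`: `h x ≡ x ^ (p ^ j) (mod 𝔓)` whenever
  `x ^ (p ^ 4) ≡ x`, with `j` odd as soon as `h y ≢ y` for some `y` with `y ^ (p ^ 2) ≡ y`;
* `inertFrob_smul_sub_pow_mem` — bookkeeping: `h (D C) ≡ C ^ e` for roots of unity `C, D` with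
  `D ≡ 1`;
* `inertFrob_conj_smul_div` — the cocycle identity `(h S h⁻¹) z / z = h ((S ζ / ζ) (S z / z))` for
  `h⁻¹ z = ζ z` (a group acting on a field by automorphisms), i.e. the Kummer cocycle of a conjugate.

References: J.-P. Serre, *Propriétés galoisiennes des points d'ordre fini des courbes elliptiques*,
Invent. Math. 15 (1972), §1.3 and §1.7 (Kummer / fundamental characters and their behaviour under
conjugation); finite fields: any textbook (e.g. Lidl–Niederreiter, Thm. 2.21).  No definitions, no
`sorry`.
-/

-- project-wide option (lakefile weak.linter.dupNamespace); `Summit.Langlands.Langlands` is mandated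
set_option linter.dupNamespace false

namespace Summit.Langlands.Langlands.Cruxes.ResidueParallel.InertFLTransfer

open Polynomial
open scoped Pointwise

section FiniteField

variable {κ : Type*} [Field κ] (p : ℕ) [Fact p.Prime] [CharP κ p]

/-- **A ring endomorphism of a field of characteristic `p` is a power of Frobenius on the solutions
of `x ^ (p ^ r) = x`** (`r ≠ 0`): there is `j` with `f x = x ^ (p ^ j)` for all such `x`.  The
solutions form a finite subfield `k` (roots of `X ^ (p ^ r) - X`), `f` restricts to an
`𝔽_p`-endomorphism of `k`, and those are the powers of the absolute Frobenius (Mathlib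
`FiniteField.bijective_frobeniusAlgHom_pow`). [folklore] -/
theorem inertFrob_exists_frobPow_of_ringHom (f : κ →+* κ) {r : ℕ} (hr : r ≠ 0) :
    ∃ j : ℕ, ∀ x : κ, x ^ (p ^ r) = x → f x = x ^ (p ^ j) := by
  classical
  -- the subfield of solutions of `x ^ (p ^ r) = x`
  let k : Subfield κ :=
    { carrier := {x | x ^ (p ^ r) = x}
      mul_mem' := fun {a b} ha hb ↦ by
        simp only [Set.mem_setOf_eq] at *
        rw [mul_pow, ha, hb]
      one_mem' := by simp
      add_mem' := fun {a b} ha hb ↦ by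
        simp only [Set.mem_setOf_eq] at *
        rw [add_pow_char_pow, ha, hb]
      zero_mem' := by
        simp only [Set.mem_setOf_eq]
        exact zero_pow (pow_ne_zero _ (Fact.out : p.Prime).ne_zero)
      neg_mem' := fun {a} ha ↦ by
        simp only [Set.mem_setOf_eq] at *
        rw [neg_pow, ha, neg_one_pow_char_pow, neg_one_mul]
      inv_mem' := fun a ha ↦ by
        simp only [Set.mem_setOf_eq] at *
        rw [inv_pow, ha] }
  have hmem : ∀ {x : κ}, x ∈ k ↔ x ^ (p ^ r) = x := Iff.rfl
  -- it is finite
  haveI : Finite k := by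
    have h1 : 1 < p ^ r := Nat.one_lt_pow hr (Fact.out : p.Prime).one_lt
    have hne : (X ^ (p ^ r) - X : κ[X]) ≠ 0 := FiniteField.X_pow_card_sub_X_ne_zero κ h1
    have hsub : (k : Set κ) ⊆ ((X ^ (p ^ r) - X : κ[X]).roots.toFinset : Set κ) := by
      intro x hx
      rw [SetLike.mem_coe, hmem] at hx
      simp only [Finset.mem_coe, Multiset.mem_toFinset, mem_roots hne, IsRoot.def, eval_sub,
        eval_pow, eval_X, hx, sub_self]
    exact Set.Finite.subset (Finset.finite_toSet _) hsub |>.to_subtype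
  letI : Algebra (ZMod p) k := ZMod.algebra _ _
  -- `f` restricts to an `𝔽_p`-endomorphism of `k`
  have hf : ∀ x : k, f x ∈ k := fun x ↦ by
    rw [hmem, ← map_pow, show (x : κ) ^ p ^ r = x from x.2]
  let g₀ : k →+* k :=
    { toFun := fun x ↦ ⟨f x, hf x⟩
      map_one' := Subtype.ext (by simp)
      map_mul' := fun x y ↦ Subtype.ext (by simp)
      map_zero' := Subtype.ext (by simp)
      map_add' := fun x y ↦ Subtype.ext (by simp) }
  have hcomm : g₀.comp (algebraMap (ZMod p) k) = algebraMap (ZMod p) k := Subsingleton.elim _ _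
  let g : k →ₐ[ZMod p] k := { g₀ with commutes' := fun c ↦ RingHom.congr_fun hcomm c }
  -- which is a power of Frobenius
  obtain ⟨⟨n, hn⟩, hgn⟩ := (FiniteField.bijective_frobeniusAlgHom_pow (ZMod p) k).2 g
  refine ⟨n, fun x hx ↦ ?_⟩
  have := congrArg (fun φ : k →ₐ[ZMod p] k ↦ ((φ ⟨x, hx⟩ : k) : κ)) hgn
  simp only [AlgHom.coe_pow, FiniteField.coe_frobeniusAlgHom, pow_iterate, ZMod.card] at this
  change _ = f x at this
  rw [← this]
  rfl

omit [Fact p.Prime] [CharP κ p] in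
/-- If `f x = x ^ (p ^ j)` for all `x` with `x ^ (p ^ 4) = x`, and `f` moves some `y` with
`y ^ (p ^ 2) = y`, then `j` is odd (for even `j`, `y ^ (p ^ j) = y`). [folklore] -/
theorem inertFrob_odd_of_frobPow {f : κ →+* κ} {j : ℕ}
    (hj : ∀ x : κ, x ^ (p ^ 4) = x → f x = x ^ (p ^ j))
    {y : κ} (hy : y ^ (p ^ 2) = y) (hfy : f y ≠ y) : Odd j := by
  by_contra hodd
  rw [Nat.not_odd_iff_even] at hodd
  obtain ⟨i, rfl⟩ := hodd
  apply hfy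
  have hy4 : y ^ (p ^ 4) = y := by
    rw [show p ^ 4 = p ^ 2 * p ^ 2 by ring, pow_mul, hy, hy]
  have key : ∀ i : ℕ, y ^ (p ^ (i + i)) = y := by
    intro i
    induction i with
    | zero => simp
    | succ i ih => rw [show i + 1 + (i + 1) = (i + i) + 2 by ring, pow_add, pow_mul, ih, hy]
  rw [hj y hy4, key]

end FiniteField

section Exponent

variable {B G : Type*} [CommRing B] [Group G] [MulSemiringAction G B]

/-- **The odd Frobenius exponent of an automorphism modulo a stable maximal ideal.**  Let `G` act on
the commutative ring `B` by automorphisms, `𝔓` a maximal ideal containing the prime `p`, `h ∈ G`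
with `h • 𝔓 = 𝔓`, and suppose `h y ≢ y (mod 𝔓)` for some `y` with `y ^ (p ^ 2) ≡ y`.  Then there is
an ODD `j` such that `h x ≡ x ^ (p ^ j) (mod 𝔓)` for every `x` with `x ^ (p ^ 4) ≡ x (mod 𝔓)`
(`inertFrob_exists_frobPow_of_ringHom` and `inertFrob_odd_of_frobPow` for the endomorphism of the
residue field `B ⧸ 𝔓` induced by `h`). [folklore] -/
theorem inertFrob_exists_odd_exponent (𝔓 : Ideal B) [𝔓.IsMaximal] (p : ℕ) [Fact p.Prime]
    (hp : (p : B) ∈ 𝔓) (h : G) (hh : h • 𝔓 = 𝔓)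
    {y : B} (hy : y ^ (p ^ 2) - y ∈ 𝔓) (hhy : h • y - y ∉ 𝔓) :
    ∃ j : ℕ, Odd j ∧ ∀ x : B, x ^ (p ^ 4) - x ∈ 𝔓 → h • x - x ^ (p ^ j) ∈ 𝔓 := by
  letI := Ideal.Quotient.field 𝔓
  haveI : CharP (B ⧸ 𝔓) p :=
    (CharP.charP_iff_prime_eq_zero Fact.out).2
      (by rw [← map_natCast (Ideal.Quotient.mk 𝔓), Ideal.Quotient.eq_zero_iff_mem]; exact hp)
  have hle : 𝔓 ≤ 𝔓.comap (MulSemiringAction.toRingHom G B h) := fun x hx ↦ by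
    rw [Ideal.mem_comap, MulSemiringAction.toRingHom_apply, ← hh]
    exact Ideal.smul_mem_pointwise_smul _ _ _ hx
  let f : B ⧸ 𝔓 →+* B ⧸ 𝔓 := Ideal.quotientMap 𝔓 (MulSemiringAction.toRingHom G B h) hle
  have hf : ∀ x : B, f (Ideal.Quotient.mk 𝔓 x) = Ideal.Quotient.mk 𝔓 (h • x) := fun x ↦
    Ideal.quotientMap_mk
  obtain ⟨j, hj⟩ := inertFrob_exists_frobPow_of_ringHom p f (r := 4) (by norm_num)
  refine ⟨j, ?_, fun x hx ↦ ?_⟩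
  · refine inertFrob_odd_of_frobPow p hj (y := Ideal.Quotient.mk 𝔓 y) ?_ ?_
    · rw [← map_pow, Ideal.Quotient.eq]; exact hy
    · rw [hf, Ne, Ideal.Quotient.eq]; exact hhy
  · have := hj (Ideal.Quotient.mk 𝔓 x) (by rw [← map_pow, Ideal.Quotient.eq]; exact hx)
    rw [hf, ← map_pow, Ideal.Quotient.eq] at this
    exact this

/-- Bookkeeping for the power law: if `h x ≡ x ^ e (mod 𝔓)` for all `N`-th roots of unity `x`, and
`C ^ N = D ^ N = 1` with `D ≡ 1 (mod 𝔓)`, then `h (D C) ≡ C ^ e (mod 𝔓)`. [folklore] -/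
theorem inertFrob_smul_sub_pow_mem (𝔓 : Ideal B) (h : G) {N e : ℕ}
    (hfrob : ∀ x : B, x ^ N = 1 → h • x - x ^ e ∈ 𝔓)
    {C D : B} (hC : C ^ N = 1) (hD : D ^ N = 1) (hD1 : D - 1 ∈ 𝔓) :
    h • (D * C) - C ^ e ∈ 𝔓 := by
  have h1 : h • (D * C) - (D * C) ^ e ∈ 𝔓 := hfrob _ (by rw [mul_pow, hC, hD, one_mul])
  have h2 : (D * C) ^ e - C ^ e ∈ 𝔓 := by
    obtain ⟨k, hk⟩ := sub_dvd_pow_sub_pow D 1 e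
    rw [one_pow] at hk
    rw [mul_pow, ← sub_one_mul, hk, mul_assoc]
    exact Ideal.mul_mem_right _ _ hD1
  have := add_mem h1 h2
  rwa [sub_add_sub_cancel] at this

end Exponent

section Cocycle

variable {L G : Type*} [Field L] [Group G] [MulSemiringAction G L]

/-- **The Kummer cocycle of a conjugate.**  For a group `G` acting on a field `L` by automorphisms,
`z ≠ 0` and `h⁻¹ z = ζ z`: `(h S h⁻¹) z / z = h ((S ζ / ζ) · (S z / z))`.  With `z` a root of
`z ^ n = a`, `S z / z` the Kummer cocycle of `S` and `ζ` an `n`-th root of unity, this is how the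
Kummer character of a conjugate `h S h⁻¹` is computed (Serre, Invent. Math. 15 (1972), §1.3,
`s(x^{1/d}) = θ_d(s) x^{1/d}`). [folklore] -/
theorem inertFrob_conj_smul_div (h S : G) {z ζ : L} (hz : z ≠ 0) (hζ : h⁻¹ • z = ζ * z) :
    (h * S * h⁻¹) • z / z = h • ((S • ζ) / ζ * ((S • z) / z)) := by
  have e1 : ∀ (g : G) (x y : L), g • (x / y) = g • x / g • y := fun g x y ↦
    map_div₀ (MulSemiringAction.toRingHom G L g) x y
  have hζ0 : ζ ≠ 0 := by
    rintro rfl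
    rw [zero_mul, smul_eq_zero_iff_eq] at hζ
    exact hz hζ
  have hz' : z = (h • ζ) * (h • z) := by
    have := congrArg (h • ·) hζ
    simp only [smul_inv_smul, smul_mul'] at this
    exact this
  have hhζ : h • ζ ≠ 0 := fun e ↦ hζ0 ((smul_eq_zero_iff_eq h).1 e)
  have hhz : h • z = z / (h • ζ) := by
    rw [eq_div_iff hhζ, mul_comm, ← hz']
  rw [mul_smul, mul_smul, hζ]
  simp only [smul_mul', e1]
  rw [hhz]
  field_simp

end Cocycle

end Summit.Langlands.Langlands.Cruxes.ResidueParallel.InertFLTransfer
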